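import Summits.ValiantsHypothesis.ValiantsHypothesis.Theorems.LacunarySymmetroidMatrixDescartesCensusLP34Box17A

/-!
# `MatrixDescartes` census — DOOR A at `(3,4)`: BOX17 IN THE KERNEL FOR PENCILS WITH A DEFINITE MIDDLE LETTER

HONEST FRAMING.  Object-search cell `pub-symmetroid`; beside the OPEN typed statement `DoorA34 = PosRootLawAt 3 4 18`
(route item `Theses.LacunarySymmetroid.DoorA34`, stmt-ValiantsHypothesis-19980), asserted nowhere.  Extension of `…CensusLP34Box16` (typer g9) to the window of width `17`: engine-2's LP34 table (`HOME/engine-2/lp34/box30/`, full certificates for `d₃ ≤ 16`) kills BOTH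
middle positions (words `IDII`, `IIDI`) on every one of the 166 3-Sidon supports with `d₃ ≤ 17` (`sidon3_box17_enum`; the first support with an
alive middle word is `(0,1,7,18)`), and parts `…CensusLP34On<tag>` put the corresponding chamber rows in the kernel (lead R1513).  Hence:

* `sidon3_box17_enum` — the 166 sorted 3-Sidon supports `0 < a < b < c ≤ 17` (`decide +kernel`);
* `lp34_box17_sorted_1/_2` — on each of them a real symmetric pencil whose letter in position `1` resp. `2` is definite has `Z₊ ≤ 18`;
* `doorA34_box17_of_middle_definite` — **for every exponent vector `d : Fin 4 → ℕ` with `d i ≤ d j + 17` and every real symmetric `3 × 3`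
  pencil `∑ X^(d l) • S l`: if some letter whose exponent lies STRICTLY BETWEEN the smallest and the largest exponent is positive or negative
  definite, then the determinant has at most `18` distinct positive roots.**

What this is NOT: end letters and all-indefinite nets are untouched — nothing on any full row `PosRootLawOn 3 4 18 d`, on `DoorA34` (OPEN), on
`ζ_sym(3,4) ∈ {18, 19}`, on `MatrixDescartes` (stmt-ValiantsHypothesis-18050) or `VP ≠ VNP`.  Two codes behind every row: engine-2's certificates
and the typer's `rows34.py` re-derivation; the kernel is the checker.  [folklore] Assembly; elementary.
-/

-- `Summit.ValiantsHypothesis.ValiantsHypothesis.…` repeats a component by the D-0017 layout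
-- (single-conjunct summit), which the `dupNamespace` linter flags; the name is mandated.
set_option linter.dupNamespace false

namespace Summit.ValiantsHypothesis.ValiantsHypothesis.Theorems.LacunarySymmetroidMatrixDescartes.Census

open Polynomial Finset
open scoped BigOperators Polynomial Matrix

/-! (continued: `sidon3_box17_enum` and `lp34_box17_sorted_1` are in the companion module `LacunarySymmetroidMatrixDescartesCensusLP34Box17A`.) -/

set_option maxHeartbeats 8000000 in
set_option maxRecDepth 8192 in
/-- **Sorted form**: on every sorted 3-Sidon support `0 = e₀ < e₁ < e₂ < e₃ ≤ 17`, a real symmetric `3 × 3` pencil whose letter in position `2` is positive or negative definite has at most `18` distinct positive det-roots (case split over `sidon3_box17_enum`; the rows are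
the typer's `doorA34_on_<d>_of_definite_letter` / `_of_definite_<l>`). [folklore] -/
theorem lp34_box17_sorted_2 (e : Fin 4 → ℕ) (he : StrictMono e) (he0 : e 0 = 0) (he3 : e 3 ≤ 17)
    (h20 : 20 ≤ ((Finset.univ : Finset (Fin 4 × Fin 4 × Fin 4)).image (fun p => e p.1 + e p.2.1 + e p.2.2)).card)
    (S : Fin 4 → Matrix (Fin 3) (Fin 3) ℝ) (hS : ∀ l, (S l).IsSymm)
    (hdef : (S 2).PosDef ∨ (-S 2).PosDef) :
    ((∑ k, ((X : ℝ[X]) ^ e k) • (S k).map C).det.roots.toFinset.filter (fun t => 0 < t)).card ≤ 18 := by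
  have hv : e = (![0, e 1, e 2, e 3] : Fin 4 → ℕ) := by funext k; fin_cases k <;> simp [he0]
  have h1 : 0 < e 1 := by have := he (show (0 : Fin 4) < 1 by decide); omega
  have h20' : 20 ≤ ((Finset.univ : Finset (Fin 4 × Fin 4 × Fin 4)).image (fun p => (![0, e 1, e 2, e 3] : Fin 4 → ℕ) p.1 +
      (![0, e 1, e 2, e 3] : Fin 4 → ℕ) p.2.1 + (![0, e 1, e 2, e 3] : Fin 4 → ℕ) p.2.2)).card := by
    rw [← hv]; exact h20
  have hmem := sidon3_box17_enum (e 3) (List.mem_range.2 (by omega)) (e 2) (List.mem_range.2 (he (by decide)))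
    (e 1) (List.mem_range.2 (he (by decide))) h1 h20'
  rw [hv]
  simp only [List.mem_cons, List.mem_nil_iff, or_false] at hmem
  rcases hmem with h | h | h | h | h | h | h | h | h | h | h | h | h | h | h | h | h | h | h | h | h | h | h | h | h | h | h | h | h | h | h | h | h | h | h | h | h | h | h | h | h | h | h | h | h | h | h | h | h | h | h | h | h | h | h | h | h | h | h | h | h | h | h | h | h | h | h | h | h | h | h | h | h | h | h | h | h | h | h | h | h | h | h | h | h | h | h | h | h | h | h | h | h | h | h | h | h | h | h | h | h | h | h | h | h | h | h | h | h | h | h | h | h | h | h | h | h | h | h | h | h | h | h | h | h | h | h | h | h | h | h | h | h | h | h | h | h | h | h | h | h | h | h | h | h | h | h | h | h | h | h | h | h | h | h | h | h | h | h | h | h | h | h | h | h | h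
  · rw [h]; exact doorA34_on_0_1_7_11_of_definite_letter S hS ⟨2, hdef⟩
  · rw [h]; exact doorA34_on_0_1_8_11_of_definite_letter S hS ⟨2, hdef⟩
  · rw [h]; exact doorA34_on_0_3_10_11_of_definite_letter S hS ⟨2, hdef⟩
  · rw [h]; exact doorA34_on_0_4_10_11_of_definite_letter S hS ⟨2, hdef⟩
  · rw [h]; exact doorA34_on_0_1_5_12_of_definite_letter S hS ⟨2, hdef⟩
  · rw [h]; exact doorA34_on_0_1_9_12_of_definite_letter S hS ⟨2, hdef⟩
  · rw [h]; exact doorA34_on_0_2_9_12_of_definite_letter S hS ⟨2, hdef⟩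
  · rw [h]; exact doorA34_on_0_3_7_12_of_definite_letter S hS ⟨2, hdef⟩
  · rw [h]; exact doorA34_on_0_3_10_12_of_definite_letter S hS ⟨2, hdef⟩
  · rw [h]; exact doorA34_on_0_3_11_12_of_definite_letter S hS ⟨2, hdef⟩
  · rw [h]; exact doorA34_on_0_5_9_12_of_definite_letter S hS ⟨2, hdef⟩
  · rw [h]; exact doorA34_on_0_7_11_12_of_definite_letter S hS ⟨2, hdef⟩
  · rw [h]; exact doorA34_on_0_1_4_13_of_definite_2 S hS hdef
  · rw [h]; exact doorA34_on_0_1_8_13_of_definite_letter S hS ⟨2, hdef⟩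
  · rw [h]; exact doorA34_on_0_1_10_13_of_definite_letter S hS ⟨2, hdef⟩
  · rw [h]; exact doorA34_on_0_2_7_13_of_definite_letter S hS ⟨2, hdef⟩
  · rw [h]; exact doorA34_on_0_2_8_13_of_definite_letter S hS ⟨2, hdef⟩
  · rw [h]; exact doorA34_on_0_2_10_13_of_definite_letter S hS ⟨2, hdef⟩
  · rw [h]; exact doorA34_on_0_3_4_13_of_definite_2 S hS hdef
  · rw [h]; exact doorA34_on_0_3_11_13_of_definite_letter S hS ⟨2, hdef⟩
  · rw [h]; exact doorA34_on_0_3_12_13_of_definite_letter S hS ⟨2, hdef⟩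
  · rw [h]; exact doorA34_on_0_5_7_13_of_definite_letter S hS ⟨2, hdef⟩
  · rw [h]; exact doorA34_on_0_5_11_13_of_definite_letter S hS ⟨2, hdef⟩
  · rw [h]; exact doorA34_on_0_5_12_13_of_definite_letter S hS ⟨2, hdef⟩
  · rw [h]; exact doorA34_on_0_6_8_13_of_definite_letter S hS ⟨2, hdef⟩
  · rw [h]; exact doorA34_on_0_6_11_13_of_definite_letter S hS ⟨2, hdef⟩
  · rw [h]; exact doorA34_on_0_9_10_13_of_definite_2 S hS hdef
  · rw [h]; exact doorA34_on_0_9_12_13_of_definite_2 S hS hdef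
  · rw [h]; exact doorA34_on_0_1_4_14_of_definite_2 S hS hdef
  · rw [h]; exact doorA34_on_0_1_6_14_of_definite_2 S hS hdef
  · rw [h]; exact doorA34_on_0_1_9_14_of_definite_letter S hS ⟨2, hdef⟩
  · rw [h]; exact doorA34_on_0_1_10_14_of_definite_letter S hS ⟨2, hdef⟩
  · rw [h]; exact doorA34_on_0_1_11_14_of_definite_2 S hS hdef
  · rw [h]; exact doorA34_on_0_2_5_14_of_definite_2 S hS hdef
  · rw [h]; exact doorA34_on_0_2_11_14_of_definite_2 S hS hdef
  · rw [h]; exact doorA34_on_0_3_4_14_of_definite_2 S hS hdef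
  · rw [h]; exact doorA34_on_0_3_5_14_of_definite_2 S hS hdef
  · rw [h]; exact doorA34_on_0_3_12_14_of_definite_2 S hS hdef
  · rw [h]; exact doorA34_on_0_3_13_14_of_definite_2 S hS hdef
  · rw [h]; exact doorA34_on_0_4_13_14_of_definite_letter S hS ⟨2, hdef⟩
  · rw [h]; exact doorA34_on_0_5_6_14_of_definite_2 S hS hdef
  · rw [h]; exact doorA34_on_0_5_13_14_of_definite_letter S hS ⟨2, hdef⟩
  · rw [h]; exact doorA34_on_0_8_9_14_of_definite_2 S hS hdef
  · rw [h]; exact doorA34_on_0_8_13_14_of_definite_2 S hS hdef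
  · rw [h]; exact doorA34_on_0_9_11_14_of_definite_2 S hS hdef
  · rw [h]; exact doorA34_on_0_9_12_14_of_definite_2 S hS hdef
  · rw [h]; exact doorA34_on_0_10_11_14_of_definite_2 S hS hdef
  · rw [h]; exact doorA34_on_0_10_13_14_of_definite_2 S hS hdef
  · rw [h]; exact doorA34_on_0_1_4_15_of_definite_2 S hS hdef
  · rw [h]; exact doorA34_on_0_1_6_15_of_definite_2 S hS hdef
  · rw [h]; exact doorA34_on_0_1_9_15_of_definite_2 S hS hdef
  · rw [h]; exact doorA34_on_0_1_11_15_of_definite_2 S hS hdef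
  · rw [h]; exact doorA34_on_0_1_12_15_of_definite_2 S hS hdef
  · rw [h]; exact doorA34_on_0_2_7_15_of_definite_2 S hS hdef
  · rw [h]; exact doorA34_on_0_2_8_15_of_definite_2 S hS hdef
  · rw [h]; exact doorA34_on_0_2_9_15_of_definite_2 S hS hdef
  · rw [h]; exact doorA34_on_0_2_12_15_of_definite_2 S hS hdef
  · rw [h]; exact doorA34_on_0_3_4_15_of_definite_2 S hS hdef
  · rw [h]; exact doorA34_on_0_3_8_15_of_definite_2 S hS hdef
  · rw [h]; exact doorA34_on_0_3_13_15_of_definite_2 S hS hdef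
  · rw [h]; exact doorA34_on_0_3_14_15_of_definite_2 S hS hdef
  · rw [h]; exact doorA34_on_0_4_9_15_of_definite_2 S hS hdef
  · rw [h]; exact doorA34_on_0_4_14_15_of_definite_2 S hS hdef
  · rw [h]; exact doorA34_on_0_6_8_15_of_definite_2 S hS hdef
  · rw [h]; exact doorA34_on_0_6_11_15_of_definite_2 S hS hdef
  · rw [h]; exact doorA34_on_0_6_13_15_of_definite_2 S hS hdef
  · rw [h]; exact doorA34_on_0_6_14_15_of_definite_2 S hS hdef
  · rw [h]; exact doorA34_on_0_7_9_15_of_definite_2 S hS hdef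
  · rw [h]; exact doorA34_on_0_7_12_15_of_definite_2 S hS hdef
  · rw [h]; exact doorA34_on_0_7_13_15_of_definite_2 S hS hdef
  · rw [h]; exact doorA34_on_0_8_13_15_of_definite_2 S hS hdef
  · rw [h]; exact doorA34_on_0_9_14_15_of_definite_2 S hS hdef
  · rw [h]; exact doorA34_on_0_11_12_15_of_definite_2 S hS hdef
  · rw [h]; exact doorA34_on_0_11_14_15_of_definite_2 S hS hdef
  · rw [h]; exact doorA34_on_0_1_4_16_of_definite_2 S hS hdef
  · rw [h]; exact doorA34_on_0_1_5_16_of_definite_2 S hS hdef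
  · rw [h]; exact doorA34_on_0_1_7_16_of_definite_2 S hS hdef
  · rw [h]; exact doorA34_on_0_1_10_16_of_definite_letter S hS ⟨2, hdef⟩
  · rw [h]; exact doorA34_on_0_1_12_16_of_definite_2 S hS hdef
  · rw [h]; exact doorA34_on_0_1_13_16_of_definite_2 S hS hdef
  · rw [h]; exact doorA34_on_0_2_5_16_of_definite_2 S hS hdef
  · rw [h]; exact doorA34_on_0_2_11_16_of_definite_2 S hS hdef
  · rw [h]; exact doorA34_on_0_2_13_16_of_definite_2 S hS hdef
  · rw [h]; exact doorA34_on_0_3_4_16_of_definite_2 S hS hdef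
  · rw [h]; exact doorA34_on_0_3_5_16_of_definite_2 S hS hdef
  · rw [h]; exact doorA34_on_0_3_7_16_of_definite_2 S hS hdef
  · rw [h]; exact doorA34_on_0_3_12_16_of_definite_2 S hS hdef
  · rw [h]; exact doorA34_on_0_3_14_16_of_definite_2 S hS hdef
  · rw [h]; exact doorA34_on_0_3_15_16_of_definite_2 S hS hdef
  · rw [h]; exact doorA34_on_0_4_5_16_of_definite_2 S hS hdef
  · rw [h]; exact doorA34_on_0_4_7_16_of_definite_2 S hS hdef
  · rw [h]; exact doorA34_on_0_4_9_16_of_definite_2 S hS hdef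
  · rw [h]; exact doorA34_on_0_4_11_16_of_definite_2 S hS hdef
  · rw [h]; exact doorA34_on_0_4_13_16_of_definite_2 S hS hdef
  · rw [h]; exact doorA34_on_0_4_15_16_of_definite_2 S hS hdef
  · rw [h]; exact doorA34_on_0_5_9_16_of_definite_2 S hS hdef
  · rw [h]; exact doorA34_on_0_5_12_16_of_definite_2 S hS hdef
  · rw [h]; exact doorA34_on_0_5_14_16_of_definite_2 S hS hdef
  · rw [h]; exact doorA34_on_0_6_7_16_of_definite_2 S hS hdef
  · rw [h]; exact doorA34_on_0_6_15_16_of_definite_letter S hS ⟨2, hdef⟩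
  · rw [h]; exact doorA34_on_0_7_11_16_of_definite_2 S hS hdef
  · rw [h]; exact doorA34_on_0_7_12_16_of_definite_2 S hS hdef
  · rw [h]; exact doorA34_on_0_9_10_16_of_definite_2 S hS hdef
  · rw [h]; exact doorA34_on_0_9_12_16_of_definite_2 S hS hdef
  · rw [h]; exact doorA34_on_0_9_13_16_of_definite_2 S hS hdef
  · rw [h]; exact doorA34_on_0_9_15_16_of_definite_2 S hS hdef
  · rw [h]; exact doorA34_on_0_11_12_16_of_definite_2 S hS hdef
  · rw [h]; exact doorA34_on_0_11_13_16_of_definite_2 S hS hdef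
  · rw [h]; exact doorA34_on_0_11_14_16_of_definite_2 S hS hdef
  · rw [h]; exact doorA34_on_0_11_15_16_of_definite_2 S hS hdef
  · rw [h]; exact doorA34_on_0_12_13_16_of_definite_2 S hS hdef
  · rw [h]; exact doorA34_on_0_12_15_16_of_definite_2 S hS hdef
  · rw [h]; exact doorA34_on_0_1_4_17_of_definite_2 S hS hdef
  · rw [h]; exact doorA34_on_0_1_5_17_of_definite_2 S hS hdef
  · rw [h]; exact doorA34_on_0_1_7_17_of_definite_2 S hS hdef
  · rw [h]; exact doorA34_on_0_1_10_17_of_definite_2 S hS hdef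
  · rw [h]; exact doorA34_on_0_1_11_17_of_definite_letter S hS ⟨2, hdef⟩
  · rw [h]; exact doorA34_on_0_1_12_17_of_definite_2 S hS hdef
  · rw [h]; exact doorA34_on_0_1_13_17_of_definite_2 S hS hdef
  · rw [h]; exact doorA34_on_0_1_14_17_of_definite_2 S hS hdef
  · rw [h]; exact doorA34_on_0_2_5_17_of_definite_2 S hS hdef
  · rw [h]; exact doorA34_on_0_2_8_17_of_definite_2 S hS hdef
  · rw [h]; exact doorA34_on_0_2_9_17_of_definite_2 S hS hdef
  · rw [h]; exact doorA34_on_0_2_10_17_of_definite_2 S hS hdef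
  · rw [h]; exact doorA34_on_0_2_11_17_of_definite_2 S hS hdef
  · rw [h]; exact doorA34_on_0_2_14_17_of_definite_2 S hS hdef
  · rw [h]; exact doorA34_on_0_3_4_17_of_definite_2 S hS hdef
  · rw [h]; exact doorA34_on_0_3_5_17_of_definite_2 S hS hdef
  · rw [h]; exact doorA34_on_0_3_8_17_of_definite_2 S hS hdef
  · rw [h]; exact doorA34_on_0_3_12_17_of_definite_2 S hS hdef
  · rw [h]; exact doorA34_on_0_3_13_17_of_definite_2 S hS hdef
  · rw [h]; exact doorA34_on_0_3_15_17_of_definite_2 S hS hdef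
  · rw [h]; exact doorA34_on_0_3_16_17_of_definite_2 S hS hdef
  · rw [h]; exact doorA34_on_0_4_5_17_of_definite_2 S hS hdef
  · rw [h]; exact doorA34_on_0_4_10_17_of_definite_2 S hS hdef
  · rw [h]; exact doorA34_on_0_4_11_17_of_definite_2 S hS hdef
  · rw [h]; exact doorA34_on_0_4_14_17_of_definite_2 S hS hdef
  · rw [h]; exact doorA34_on_0_4_16_17_of_definite_2 S hS hdef
  · rw [h]; exact doorA34_on_0_5_8_17_of_definite_2 S hS hdef
  · rw [h]; exact doorA34_on_0_5_14_17_of_definite_2 S hS hdef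
  · rw [h]; exact doorA34_on_0_5_16_17_of_definite_2 S hS hdef
  · rw [h]; exact doorA34_on_0_6_7_17_of_definite_2 S hS hdef
  · rw [h]; exact doorA34_on_0_6_8_17_of_definite_2 S hS hdef
  · rw [h]; exact doorA34_on_0_6_10_17_of_definite_2 S hS hdef
  · rw [h]; exact doorA34_on_0_6_13_17_of_definite_2 S hS hdef
  · rw [h]; exact doorA34_on_0_6_15_17_of_definite_2 S hS hdef
  · rw [h]; exact doorA34_on_0_6_16_17_of_definite_letter S hS ⟨2, hdef⟩
  · rw [h]; exact doorA34_on_0_7_9_17_of_definite_2 S hS hdef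
  · rw [h]; exact doorA34_on_0_7_11_17_of_definite_2 S hS hdef
  · rw [h]; exact doorA34_on_0_7_13_17_of_definite_2 S hS hdef
  · rw [h]; exact doorA34_on_0_7_15_17_of_definite_2 S hS hdef
  · rw [h]; exact doorA34_on_0_7_16_17_of_definite_2 S hS hdef
  · rw [h]; exact doorA34_on_0_8_10_17_of_definite_2 S hS hdef
  · rw [h]; exact doorA34_on_0_8_15_17_of_definite_2 S hS hdef
  · rw [h]; exact doorA34_on_0_9_11_17_of_definite_2 S hS hdef
  · rw [h]; exact doorA34_on_0_9_12_17_of_definite_2 S hS hdef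
  · rw [h]; exact doorA34_on_0_9_14_17_of_definite_2 S hS hdef
  · rw [h]; exact doorA34_on_0_9_15_17_of_definite_2 S hS hdef
  · rw [h]; exact doorA34_on_0_10_11_17_of_definite_2 S hS hdef
  · rw [h]; exact doorA34_on_0_10_16_17_of_definite_2 S hS hdef
  · rw [h]; exact doorA34_on_0_12_13_17_of_definite_2 S hS hdef
  · rw [h]; exact doorA34_on_0_12_14_17_of_definite_2 S hS hdef
  · rw [h]; exact doorA34_on_0_12_15_17_of_definite_2 S hS hdef
  · rw [h]; exact doorA34_on_0_12_16_17_of_definite_2 S hS hdef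
  · rw [h]; exact doorA34_on_0_13_14_17_of_definite_2 S hS hdef
  · rw [h]; exact doorA34_on_0_13_16_17_of_definite_2 S hS hdef


/-- **DOOR A ON THE WINDOW OF WIDTH 17 FOR PENCILS WITH A DEFINITE MIDDLE LETTER.**  Let `d : Fin 4 → ℕ` be any exponent vector with
`d i ≤ d j + 17` for all `i, j`, and `S` real symmetric `3 × 3` letters.  If some letter `S l` whose exponent lies strictly between the smallest
and the largest exponent (`∃ i j, d i < d l < d j`) is positive or negative definite, then `det (∑ X^(d l) • S l)` has at most `18` distinct
positive roots. [folklore] -/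
theorem doorA34_box17_of_middle_definite (d : Fin 4 → ℕ) (hw : ∀ i j, d i ≤ d j + 17)
    (S : Fin 4 → Matrix (Fin 3) (Fin 3) ℝ) (hS : ∀ l, (S l).IsSymm)
    (hmid : ∃ l, (∃ i, d i < d l) ∧ (∃ j, d l < d j) ∧ ((S l).PosDef ∨ (-S l).PosDef)) :
    ((∑ k, ((X : ℝ[X]) ^ d k) • (S k).map C).det.roots.toFinset.filter (fun t => 0 < t)).card ≤ 18 := by
  classical
  by_cases hinj : Function.Injective d
  · set σ := Tuple.sort d with hσ
    have hmono : Monotone (d ∘ σ) := Tuple.monotone_sort d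
    have hsm : StrictMono (d ∘ σ) := hmono.strictMono_of_injective (hinj.comp σ.injective)
    set m := (d ∘ σ) 0 with hm
    have hmle : ∀ l, m ≤ (d ∘ σ) l := fun l => hmono (Fin.zero_le l)
    set e : Fin 4 → ℕ := fun l => (d ∘ σ) l - m with hedef
    have hde : ∀ l, d (σ l) = e l + m := by
      intro l; simp only [hedef, Function.comp]; have := hmle l; simp only [Function.comp] at this; omega
    have he_mono : StrictMono e := by intro a b hab; simp only [hedef]; have := hsm hab; have := hmle a; omega
    have he0 : e 0 = 0 := by simp [hedef, hm]
    have he3 : e 3 ≤ 17 := by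
      simp only [hedef]; have := hw (σ 3) (σ 0); simp only [hm, Function.comp] at this ⊢; omega
    have hpen : (∑ k, ((X : ℝ[X]) ^ d k) • (S k).map C) = (X : ℝ[X]) ^ m • ∑ k, ((X : ℝ[X]) ^ e k) • ((S ∘ σ) k).map C := by
      rw [← pencil_comp_equiv σ d S, Finset.smul_sum]
      refine Finset.sum_congr rfl fun k _ => ?_
      rw [hde, smul_smul, ← pow_add, add_comm, Function.comp_apply]
    have hcard : ((∑ k, ((X : ℝ[X]) ^ d k) • (S k).map C).det.roots.toFinset.filter (fun t => 0 < t)).card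
        = ((∑ k, ((X : ℝ[X]) ^ e k) • ((S ∘ σ) k).map C).det.roots.toFinset.filter (fun t => 0 < t)).card := by
      rw [hpen, Matrix.det_smul, Fintype.card_fin, ← pow_mul, posRoots_X_pow_mul_eq]
    rw [hcard]
    by_cases hc : ((Finset.univ : Finset (Fin 4 × Fin 4 × Fin 4)).image (fun p => e p.1 + e p.2.1 + e p.2.2)).card ≤ 19
    · exact doorA34_on_of_card_tripleSums_le e hc (S ∘ σ) (fun k => hS _)
    · obtain ⟨l, ⟨i, hi⟩, ⟨j, hj⟩, hdef⟩ := hmid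
      have hil : e (σ.symm i) < e (σ.symm l) := by
        have h1 := hde (σ.symm i); have h2 := hde (σ.symm l); rw [Equiv.apply_symm_apply] at h1 h2; omega
      have hlj : e (σ.symm l) < e (σ.symm j) := by
        have h1 := hde (σ.symm l); have h2 := hde (σ.symm j); rw [Equiv.apply_symm_apply] at h1 h2; omega
      have hl12 : σ.symm l = 1 ∨ σ.symm l = 2 := by
        have hlo : e 0 ≤ e (σ.symm i) := he_mono.monotone (Fin.zero_le _)
        have hhi : e (σ.symm j) ≤ e 3 := he_mono.monotone (Fin.le_last _)
        have hne0 : σ.symm l ≠ 0 := by intro h0; rw [h0] at hil; omega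
        have hne3 : σ.symm l ≠ 3 := by intro h3; rw [h3] at hlj; omega
        revert hne0 hne3; generalize σ.symm l = x; intro hne0 hne3; fin_cases x <;> simp_all
      have hdef' : ((S ∘ σ) (σ.symm l)).PosDef ∨ (-(S ∘ σ) (σ.symm l)).PosDef := by
        simpa [Function.comp, Equiv.apply_symm_apply] using hdef
      rcases hl12 with h12 | h12 <;> rw [h12] at hdef'
      · exact lp34_box17_sorted_1 e he_mono he0 he3 (by omega) (S ∘ σ) (fun k => hS _) hdef'
      · exact lp34_box17_sorted_2 e he_mono he0 he3 (by omega) (S ∘ σ) (fun k => hS _) hdef'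
  · exact doorA34_on_of_not_injective d hinj S hS

end Summit.ValiantsHypothesis.ValiantsHypothesis.Theorems.LacunarySymmetroidMatrixDescartes.Census
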